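import Summits.CriticalPhenomena.PercolationContinuityZ3.Theorems.PercNearOneGluingNoHeavyLowerTailCILStarTransfer
import HarnessLib

/-!
# `NoHeavyLowerTail` (stmt-CriticalPhenomena-4575) — the peeling step for set-champion stability

Support file (prover `prim-gen-induct`, blob-quotient / cumulative-isolation line; `--supports
stmt-CriticalPhenomena-4575`).  No definitions, no named facts, no sorries.

Notation: `μ_w = prodBernoulli w` on `Fin n`, relays `A`, level `j`, `π(v) = {z ∈ A : v ↔ z}`, `π(S) = ⋃_{x∈S} π(x)`.  For a
vertex set `S` and a vertex `c` the SET-CHAMPION-STABILITY inequality is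

  `CS_w(S, c) :  μ_w(c ↮ S, 1 ≤ |π(S)| ≤ j) ≤ μ_w(c ↮ S, |π(c)| ≤ j)`

(spelled exactly as in `Literature.….observerSet_le_of_lonelier`, which PROVES it whenever `S` contains a vertex `y` with
`μ_w{|π(y)| ≤ j} ≤ μ_w{|π(c)| ≤ j}`; for `S = {o}` and `c ∈ A` it is CIL_j at `o` with the witness `c`, see `cil_of_setCS_singleton`;
for `S = {x, y}` and `c` a champion it is the registered `stub_championStabilityPair`).  Write `w ∖ v` for the weights with the
edges at `v` switched off (`fun e => if e ∈ {e | v ∉ e} then w e else 0`, the graph `G − v` on the same vertex type).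

* `setCS_of_peeling` — **the peeling step.**  Let `v ∈ S` be a non-relay.  If `CS_{w∖v}((S ∖ v) ∪ B, c)` holds for every set `B`
  of positive-weight neighbours of `v` with `c ∉ B` and `(S ∖ v) ∪ B ≠ ∅`, then `CS_w(S, c)`.  Mechanism (exact identity behind it):
  on the star `σ_B` of `v` the cluster of `S` is `v` plus the `G − v`-clusters of `(S ∖ v) ∪ B`, `c ↮ S` iff `c ↮' (S ∖ v) ∪ B`, and
  then `π(c) = π'(c)`; the star is independent of the configuration off `v` (`CutObserver.measureReal_starEvent_inter_avoid`).
* `cil_of_setCS_singleton` — `CS_w({o}, q) ⇒ μ_w{1 ≤ N ≤ j} ≤ μ_w{|π(q)| ≤ j}` (on `{q ↔ o}` the left event is inside the right one).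

With `Theorems.cil_of_starStability` (the root step) these two lemmas and `observerSet_le_of_lonelier` form a complete recursive
certificate scheme for CIL_j ("peeling certificate": discharge a node as soon as its observer set contains a vertex no lighter than the
witness; at a singleton non-relay node the witness may be replaced by any no-lighter relay; otherwise peel a non-relay of the set).
Exact-enumeration census (this seat, crux notes BLOBQUOTIENT.md §9, kit j039477): the scheme certifies CIL in ≈ 99.7 % of random
weighted instances on `n ≤ 8` vertices (all levels, all observers); the residue is witness lock-in at tight symmetric sub-configurations
(smallest: the 4-cycle `0–5–1–6–0`, `A = {0,1,6}`, observer `5`, `j = 1`, where `μ{N = 1} = μ{|π(6)| ≤ 1} = 1/4` exactly).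
-/

noncomputable section

namespace Summit.CriticalPhenomena.PercolationContinuityZ3.Theorems

open MeasureTheory Set Literature.Probability.LatticeModels Literature.Probability.Percolation
open scoped Classical BigOperators

variable {n : ℕ}

namespace CutObserver

/-- On the star `σ_B` of `v` with `v ∈ S`: a vertex `z ≠ v` is joined to some vertex of `S` iff it is joined, avoiding `v`, to some
vertex of `(S ∖ v) ∪ B`. [folklore] -/
theorem exists_reachable_set_iff_star {ω : BondConfig (Fin n)} {v : Fin n} {B S : Finset (Fin n)}
    (hσ : ω ∈ starEvent v (↑B : Set (Fin n))) (hvS : v ∈ S) (hBv : ∀ y ∈ B, y ≠ v) {z : Fin n} (hzv : z ≠ v) :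
    (∃ x ∈ S, (openGraph ω).Reachable x z) ↔
      ∃ y ∈ S.erase v ∪ B, (openGraph (ω ∩ {e | v ∉ e})).Reachable y z := by
  constructor
  · rintro ⟨x, hxS, hxz⟩
    by_cases hxv : (openGraph ω).Reachable x v
    · -- through `v`: the star gives a vertex of `B`
      obtain ⟨y, hyB, hyz⟩ := exists_avoid_of_reachable_star hσ hzv (hxv.symm.trans hxz)
      exact ⟨y, Finset.mem_union_right _ (Finset.mem_coe.1 hyB), hyz⟩
    · have hxv' : x ≠ v := fun h => hxv (h ▸ SimpleGraph.Reachable.refl _)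
      exact ⟨x, Finset.mem_union_left _ (Finset.mem_erase.2 ⟨hxv', hxS⟩),
        reachable_avoiding_of_not_reachable hxv hxz⟩
  · rintro ⟨y, hy, hyz⟩
    rcases Finset.mem_union.1 hy with hy' | hyB
    · exact ⟨y, (Finset.mem_erase.1 hy').2, reachable_mono inter_subset_left hyz⟩
    · exact ⟨v, hvS, reachable_of_mem_star hσ (hBv y hyB) (Finset.mem_coe.2 hyB) hyz⟩

/-- On the star `σ_B` of `v` with `v ∈ S`: `c` is separated from `S` iff it is separated, avoiding `v`, from `(S ∖ v) ∪ B`. [folklore] -/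
theorem forall_not_reachable_set_iff_star {ω : BondConfig (Fin n)} {v : Fin n} {B S : Finset (Fin n)}
    (hσ : ω ∈ starEvent v (↑B : Set (Fin n))) (hvS : v ∈ S) (hBv : ∀ y ∈ B, y ≠ v) {c : Fin n} (hcS : c ∉ S) :
    (∀ x ∈ S, ¬ (openGraph ω).Reachable c x) ↔
      ∀ y ∈ S.erase v ∪ B, ¬ (openGraph (ω ∩ {e | v ∉ e})).Reachable c y := by
  have hcv : c ≠ v := fun h => hcS (h ▸ hvS)
  constructor
  · intro h y hy hcy
    rcases Finset.mem_union.1 hy with hy' | hyB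
    · exact h y (Finset.mem_erase.1 hy').2 (reachable_mono inter_subset_left hcy)
    · exact h v hvS ((reachable_of_mem_star hσ (hBv y hyB) (Finset.mem_coe.2 hyB) hcy.symm).symm)
  · intro h x hxS hcx
    by_cases hcv' : (openGraph ω).Reachable c v
    · obtain ⟨y, hyB, hyc⟩ := exists_avoid_of_reachable_star hσ hcv hcv'.symm
      exact h y (Finset.mem_union_right _ (Finset.mem_coe.1 hyB)) hyc.symm
    · have hxv : x ≠ v := fun hx => hcv' (hx ▸ hcx)
      exact h x (Finset.mem_union_left _ (Finset.mem_erase.2 ⟨hxv, hxS⟩))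
        (reachable_avoiding_of_not_reachable hcv' hcx)

/-- **Peeling step, one star.**  `v ∈ S` a non-relay, `c ∉ S`, `B` a set of vertices `≠ v`, `S' = (S ∖ v) ∪ B`; events off `v` are
read on `ω ∩ {e | v ∉ e}`.  If `μ(c ↮' S', 1 ≤ |π'(S')| ≤ j) ≤ μ(c ↮' S', |π'(c)| ≤ j)` then
`μ({c ↮ S, 1 ≤ |π(S)| ≤ j} ∩ σ_B) ≤ μ({c ↮ S, |π(c)| ≤ j} ∩ σ_B)`. [folklore] -/
theorem set_star_transfer (w : Sym2 (Fin n) → unitInterval) (A S : Finset (Fin n)) (v c : Fin n) (j : ℕ)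
    (hvS : v ∈ S) (hvA : v ∉ A) (hcS : c ∉ S) (B : Finset (Fin n)) (hBv : ∀ y ∈ B, y ≠ v)
    (hCS : (prodBernoulli w).real {ω : BondConfig (Fin n) |
        (∀ y ∈ S.erase v ∪ B, ¬ (openGraph (ω ∩ {e | v ∉ e})).Reachable c y) ∧
          1 ≤ (A.filter fun z => ∃ y ∈ S.erase v ∪ B, (openGraph (ω ∩ {e | v ∉ e})).Reachable y z).card ∧
          (A.filter fun z => ∃ y ∈ S.erase v ∪ B, (openGraph (ω ∩ {e | v ∉ e})).Reachable y z).card ≤ j} ≤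
      (prodBernoulli w).real {ω : BondConfig (Fin n) |
        (∀ y ∈ S.erase v ∪ B, ¬ (openGraph (ω ∩ {e | v ∉ e})).Reachable c y) ∧
          (A.filter fun z => (openGraph (ω ∩ {e | v ∉ e})).Reachable c z).card ≤ j}) :
    (prodBernoulli w).real ({ω : BondConfig (Fin n) | (∀ x ∈ S, ω ∉ openConn c x) ∧
        1 ≤ (A.filter fun z => ∃ x ∈ S, ω ∈ openConn x z).card ∧
        (A.filter fun z => ∃ x ∈ S, ω ∈ openConn x z).card ≤ j} ∩ starEvent v ↑B) ≤
      (prodBernoulli w).real ({ω : BondConfig (Fin n) | (∀ x ∈ S, ω ∉ openConn c x) ∧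
        (A.filter fun z => ω ∈ openConn c z).card ≤ j} ∩ starEvent v ↑B) := by
  haveI : IsProbabilityMeasure (prodBernoulli w) := inferInstance
  set μ := prodBernoulli w with hμ
  set σ := starEvent v (↑B : Set (Fin n)) with hσdef
  set S' := S.erase v ∪ B with hS'
  set PL : BondConfig (Fin n) → Prop := fun ξ =>
    (∀ y ∈ S', ¬ (openGraph ξ).Reachable c y) ∧
      1 ≤ (A.filter fun z => ∃ y ∈ S', (openGraph ξ).Reachable y z).card ∧
      (A.filter fun z => ∃ y ∈ S', (openGraph ξ).Reachable y z).card ≤ j with hPL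
  set PR : BondConfig (Fin n) → Prop := fun ξ =>
    (∀ y ∈ S', ¬ (openGraph ξ).Reachable c y) ∧ (A.filter fun z => (openGraph ξ).Reachable c z).card ≤ j with hPR
  set LS := {ω : BondConfig (Fin n) | (∀ x ∈ S, ω ∉ openConn c x) ∧
    1 ≤ (A.filter fun z => ∃ x ∈ S, ω ∈ openConn x z).card ∧
    (A.filter fun z => ∃ x ∈ S, ω ∈ openConn x z).card ≤ j} with hLS
  set RS := {ω : BondConfig (Fin n) | (∀ x ∈ S, ω ∉ openConn c x) ∧
    (A.filter fun z => ω ∈ openConn c z).card ≤ j} with hRS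
  -- π(S) = π'(S') on σ (relays are ≠ v)
  have hfilt : ∀ ω ∈ σ, (A.filter fun z => ∃ x ∈ S, ω ∈ openConn x z) =
      (A.filter fun z => ∃ y ∈ S', (openGraph (ω ∩ {e | v ∉ e})).Reachable y z) := by
    intro ω hω
    refine Finset.filter_congr fun z hz => ?_
    have hzv : z ≠ v := fun h => hvA (h ▸ hz)
    exact exists_reachable_set_iff_star hω hvS hBv hzv
  -- off S, π(c) = π'(c)
  have hfiltc : ∀ ω, (∀ x ∈ S, ω ∉ openConn c x) →
      (A.filter fun z => ω ∈ openConn c z) = (A.filter fun z => (openGraph (ω ∩ {e | v ∉ e})).Reachable c z) := by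
    intro ω h
    have hcv : ¬ (openGraph ω).Reachable c v := h v hvS
    refine Finset.filter_congr fun z _ => ⟨fun hz => ?_, fun hz => reachable_mono inter_subset_left hz⟩
    exact reachable_avoiding_of_not_reachable hcv hz
  have hL : LS ∩ σ = σ ∩ {ω | PL (ω ∩ {e | v ∉ e})} := by
    ext ω
    simp only [hLS, mem_inter_iff, mem_setOf_eq]
    constructor
    · rintro ⟨⟨hsep, h1, h2⟩, hω⟩
      refine ⟨hω, (forall_not_reachable_set_iff_star hω hvS hBv hcS).1 hsep, ?_, ?_⟩
      · rw [← hfilt ω hω]; exact h1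
      · rw [← hfilt ω hω]; exact h2
    · rintro ⟨hω, hsep, h1, h2⟩
      refine ⟨⟨(forall_not_reachable_set_iff_star hω hvS hBv hcS).2 hsep, ?_, ?_⟩, hω⟩
      · rw [hfilt ω hω]; exact h1
      · rw [hfilt ω hω]; exact h2
  have hR : RS ∩ σ = σ ∩ {ω | PR (ω ∩ {e | v ∉ e})} := by
    ext ω
    simp only [hRS, mem_inter_iff, mem_setOf_eq]
    constructor
    · rintro ⟨⟨hsep, h2⟩, hω⟩
      refine ⟨hω, (forall_not_reachable_set_iff_star hω hvS hBv hcS).1 hsep, ?_⟩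
      rw [← hfiltc ω hsep]; exact h2
    · rintro ⟨hω, hsep, h2⟩
      have hsep' := (forall_not_reachable_set_iff_star hω hvS hBv hcS).2 hsep
      refine ⟨⟨hsep', ?_⟩, hω⟩
      rw [hfiltc ω hsep']; exact h2
  rw [hL, hR, measureReal_starEvent_inter_avoid w v ↑B PL, measureReal_starEvent_inter_avoid w v ↑B PR]
  exact mul_le_mul_of_nonneg_left hCS measureReal_nonneg

end CutObserver

open CutObserver KNPreFKG in
/-- **The peeling step for set-champion stability.**  Let `S` be a finite vertex set, `v ∈ S` a non-relay (`v ∉ A`), `c ∉ S`.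
Suppose that in the graph with the edges at `v` switched off (weights `w ∖ v`), for every finite set `B` of positive-weight
neighbours of `v` (`y ≠ v`, `w s(v,y) ≠ 0`) with `c ∉ B` and `S' = (S ∖ v) ∪ B` nonempty,
`μ_{w∖v}(c ↮ S', 1 ≤ |π(S')| ≤ j) ≤ μ_{w∖v}(c ↮ S', |π(c)| ≤ j)`.  Then `μ_w(c ↮ S, 1 ≤ |π(S)| ≤ j) ≤ μ_w(c ↮ S, |π(c)| ≤ j)`.
Proof: sum `CutObserver.set_star_transfer` over the stars of `v` (`KNPreFKG.real_eq_sum_inter_starEvent`); the hypothesis is moved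
from `w ∖ v` to events of `ω ∩ {e | v ∉ e}` under `μ_w` by `CutObserver.measureReal_preimage_avoid`; stars `B ∋ c` or with
`S' = ∅` carry no mass of the left event. [folklore] -/
theorem setCS_of_peeling (w : Sym2 (Fin n) → unitInterval) (A S : Finset (Fin n)) (v c : Fin n) (j : ℕ)
    (hvS : v ∈ S) (hvA : v ∉ A) (hcS : c ∉ S)
    (hCS : ∀ B : Finset (Fin n), (∀ y ∈ B, y ≠ v ∧ w s(v, y) ≠ 0) → c ∉ B → (S.erase v ∪ B).Nonempty →
      (prodBernoulli fun e => if e ∈ {e : Sym2 (Fin n) | v ∉ e} then w e else 0).real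
          {ω : BondConfig (Fin n) | (∀ x ∈ S.erase v ∪ B, ω ∉ openConn c x) ∧
            1 ≤ (A.filter fun z => ∃ x ∈ S.erase v ∪ B, ω ∈ openConn x z).card ∧
            (A.filter fun z => ∃ x ∈ S.erase v ∪ B, ω ∈ openConn x z).card ≤ j} ≤
        (prodBernoulli fun e => if e ∈ {e : Sym2 (Fin n) | v ∉ e} then w e else 0).real
          {ω : BondConfig (Fin n) | (∀ x ∈ S.erase v ∪ B, ω ∉ openConn c x) ∧
            (A.filter fun z => ω ∈ openConn c z).card ≤ j}) :
    (prodBernoulli w).real {ω : BondConfig (Fin n) | (∀ x ∈ S, ω ∉ openConn c x) ∧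
        1 ≤ (A.filter fun z => ∃ x ∈ S, ω ∈ openConn x z).card ∧
        (A.filter fun z => ∃ x ∈ S, ω ∈ openConn x z).card ≤ j} ≤
      (prodBernoulli w).real {ω : BondConfig (Fin n) | (∀ x ∈ S, ω ∉ openConn c x) ∧
        (A.filter fun z => ω ∈ openConn c z).card ≤ j} := by
  haveI : IsProbabilityMeasure (prodBernoulli w) := inferInstance
  set μ := prodBernoulli w with hμ
  set LS := {ω : BondConfig (Fin n) | (∀ x ∈ S, ω ∉ openConn c x) ∧
    1 ≤ (A.filter fun z => ∃ x ∈ S, ω ∈ openConn x z).card ∧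
    (A.filter fun z => ∃ x ∈ S, ω ∈ openConn x z).card ≤ j} with hLS
  set RS := {ω : BondConfig (Fin n) | (∀ x ∈ S, ω ∉ openConn c x) ∧
    (A.filter fun z => ω ∈ openConn c z).card ≤ j} with hRS
  set Γ : Finset (Fin n) := Finset.univ.filter fun y => y ≠ v ∧ w s(v, y) ≠ 0 with hΓ
  have hΓv : v ∉ Γ := by rw [hΓ, Finset.mem_filter]; exact fun h => h.2.1 rfl
  have hiso : ∀ y, y ≠ v → y ∉ Γ → w s(v, y) = 0 := by
    intro y hyv hyΓ; by_contra hne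
    exact hyΓ (Finset.mem_filter.2 ⟨Finset.mem_univ _, hyv, hne⟩)
  rw [real_eq_sum_inter_starEvent w Γ v hΓv hiso LS, real_eq_sum_inter_starEvent w Γ v hΓv hiso RS]
  refine Finset.sum_le_sum fun B hB => ?_
  have hBΓ : B ⊆ Γ := Finset.mem_powerset.1 hB
  have hBv : ∀ y ∈ B, y ≠ v := fun y hy => (Finset.mem_filter.1 (hBΓ hy)).2.1
  by_cases hcB : c ∈ B
  · -- `c ∈ B`: the edge `v–c` is open on the star, so `c ↔ v ∈ S` and the left event is empty
    have h0 : LS ∩ starEvent v ↑B = ∅ := by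
      ext ω
      simp only [hLS, mem_inter_iff, mem_setOf_eq, mem_empty_iff_false, iff_false, not_and]
      intro hsep hω
      have hcv : c ≠ v := fun h => hcS (h ▸ hvS)
      exact hsep.1 v hvS ((reachable_of_mem_star hω hcv (Finset.mem_coe.2 hcB)
        (SimpleGraph.Reachable.refl _)).symm)
    rw [h0, measureReal_empty]; exact measureReal_nonneg
  by_cases hne : (S.erase v ∪ B).Nonempty
  · refine set_star_transfer w A S v c j hvS hvA hcS B hBv ?_
    have key := hCS B (fun y hy => ⟨hBv y hy, (Finset.mem_filter.1 (hBΓ hy)).2.2⟩) hcB hne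
    have e2 : {ω : BondConfig (Fin n) |
        (∀ y ∈ S.erase v ∪ B, ¬ (openGraph (ω ∩ {e | v ∉ e})).Reachable c y) ∧
          1 ≤ (A.filter fun z => ∃ y ∈ S.erase v ∪ B, (openGraph (ω ∩ {e | v ∉ e})).Reachable y z).card ∧
          (A.filter fun z => ∃ y ∈ S.erase v ∪ B, (openGraph (ω ∩ {e | v ∉ e})).Reachable y z).card ≤ j} =
        {ω : BondConfig (Fin n) | ω ∩ {e | v ∉ e} ∈
          {ξ : BondConfig (Fin n) | (∀ x ∈ S.erase v ∪ B, ξ ∉ openConn c x) ∧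
            1 ≤ (A.filter fun z => ∃ x ∈ S.erase v ∪ B, ξ ∈ openConn x z).card ∧
            (A.filter fun z => ∃ x ∈ S.erase v ∪ B, ξ ∈ openConn x z).card ≤ j}} := by
      ext ω; simp only [mem_setOf_eq, filter_avoid_exists_eq]; exact Iff.rfl
    have e3 : {ω : BondConfig (Fin n) |
        (∀ y ∈ S.erase v ∪ B, ¬ (openGraph (ω ∩ {e | v ∉ e})).Reachable c y) ∧
          (A.filter fun z => (openGraph (ω ∩ {e | v ∉ e})).Reachable c z).card ≤ j} =
        {ω : BondConfig (Fin n) | ω ∩ {e | v ∉ e} ∈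
          {ξ : BondConfig (Fin n) | (∀ x ∈ S.erase v ∪ B, ξ ∉ openConn c x) ∧
            (A.filter fun z => ξ ∈ openConn c z).card ≤ j}} := by
      ext ω; simp only [mem_setOf_eq, filter_avoid_eq]; exact Iff.rfl
    rw [e2, e3, measureReal_preimage_avoid, measureReal_preimage_avoid]
    convert key using 12
  · -- `S' = ∅`: then `S = {v}`, `B = ∅`, and `v` is isolated on the star: `π(S) = ∅`
    rw [Finset.not_nonempty_iff_eq_empty, Finset.union_eq_empty] at hne
    obtain ⟨hSe, rfl⟩ := hne
    have h0 : LS ∩ starEvent v ↑(∅ : Finset (Fin n)) = ∅ := by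
      ext ω
      simp only [hLS, mem_inter_iff, mem_setOf_eq, mem_empty_iff_false, iff_false, not_and]
      intro hω' hω
      rw [Finset.coe_empty] at hω
      obtain ⟨z, hz⟩ := Finset.card_pos.1 (lt_of_lt_of_le Nat.zero_lt_one hω'.2.1)
      rw [Finset.mem_filter] at hz
      obtain ⟨x, hxS, hxz⟩ := hz.2
      have hxv : x = v := by
        by_contra hxv
        have : x ∈ S.erase v := Finset.mem_erase.2 ⟨hxv, hxS⟩
        rw [hSe] at this; exact absurd this (Finset.notMem_empty _)
      subst hxv
      exact not_reachable_of_mem_starEvent_empty hω (fun h => hvA (h ▸ hz.1)) hxz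
    rw [h0, measureReal_empty]; exact measureReal_nonneg

/-- **From set-champion stability at `{o}` to CIL.**  If `μ(q ↮ o, 1 ≤ N ≤ j) ≤ μ(q ↮ o, |π(q)| ≤ j)` then
`μ{1 ≤ N ≤ j} ≤ μ{|π(q)| ≤ j}`: on `{q ↔ o}` one has `π(q) = π(o)`, so the remaining parts are nested. [folklore] -/
theorem cil_of_setCS_singleton (w : Sym2 (Fin n) → unitInterval) (A : Finset (Fin n)) (o q : Fin n) (j : ℕ)
    (hCS : (prodBernoulli w).real {ω : BondConfig (Fin n) | (∀ x ∈ ({o} : Finset (Fin n)), ω ∉ openConn q x) ∧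
        1 ≤ (A.filter fun z => ∃ x ∈ ({o} : Finset (Fin n)), ω ∈ openConn x z).card ∧
        (A.filter fun z => ∃ x ∈ ({o} : Finset (Fin n)), ω ∈ openConn x z).card ≤ j} ≤
      (prodBernoulli w).real {ω : BondConfig (Fin n) | (∀ x ∈ ({o} : Finset (Fin n)), ω ∉ openConn q x) ∧
        (A.filter fun z => ω ∈ openConn q z).card ≤ j}) :
    (prodBernoulli w).real {ω : BondConfig (Fin n) |
        1 ≤ (A.filter fun x => ω ∈ openConn o x).card ∧ (A.filter fun x => ω ∈ openConn o x).card ≤ j} ≤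
      (prodBernoulli w).real {ω : BondConfig (Fin n) | (A.filter fun x => ω ∈ openConn q x).card ≤ j} := by
  haveI : IsProbabilityMeasure (prodBernoulli w) := inferInstance
  set μ := prodBernoulli w with hμ
  set L := {ω : BondConfig (Fin n) |
    1 ≤ (A.filter fun x => ω ∈ openConn o x).card ∧ (A.filter fun x => ω ∈ openConn o x).card ≤ j} with hL
  set R := {ω : BondConfig (Fin n) | (A.filter fun x => ω ∈ openConn q x).card ≤ j} with hR
  set V := (openConn q o : Set (BondConfig (Fin n))) with hV
  have hfo : ∀ ω, (A.filter fun z => ∃ x ∈ ({o} : Finset (Fin n)), ω ∈ openConn x z) =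
      (A.filter fun x => ω ∈ openConn o x) := by
    intro ω
    refine Finset.filter_congr fun z _ => ?_
    simp only [Finset.mem_singleton, exists_eq_left]
  have hLV : L \ V = {ω : BondConfig (Fin n) | (∀ x ∈ ({o} : Finset (Fin n)), ω ∉ openConn q x) ∧
      1 ≤ (A.filter fun z => ∃ x ∈ ({o} : Finset (Fin n)), ω ∈ openConn x z).card ∧
      (A.filter fun z => ∃ x ∈ ({o} : Finset (Fin n)), ω ∈ openConn x z).card ≤ j} := by
    ext ω
    constructor
    · rintro ⟨⟨h1, h2⟩, hVω⟩
      refine ⟨fun x hx => ?_, ?_, ?_⟩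
      · rw [Finset.mem_singleton] at hx; subst hx; exact hVω
      · rw [hfo ω]; exact h1
      · rw [hfo ω]; exact h2
    · rintro ⟨hsep, h1, h2⟩
      refine ⟨⟨?_, ?_⟩, hsep o (Finset.mem_singleton_self o)⟩
      · rw [hfo ω] at h1; exact h1
      · rw [hfo ω] at h2; exact h2
  have hRV : R \ V = {ω : BondConfig (Fin n) | (∀ x ∈ ({o} : Finset (Fin n)), ω ∉ openConn q x) ∧
      (A.filter fun z => ω ∈ openConn q z).card ≤ j} := by
    ext ω
    constructor
    · rintro ⟨h2, hVω⟩
      refine ⟨fun x hx => ?_, h2⟩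
      rw [Finset.mem_singleton] at hx; subst hx; exact hVω
    · rintro ⟨hsep, h2⟩
      exact ⟨h2, hsep o (Finset.mem_singleton_self o)⟩
  have hin : L ∩ V ⊆ R ∩ V := by
    rintro ω ⟨hLω, hVω⟩
    refine ⟨?_, hVω⟩
    show (A.filter fun x => ω ∈ openConn q x).card ≤ j
    have hqo : (openGraph ω).Reachable q o := hVω
    have heq : (A.filter fun x => ω ∈ openConn q x) = (A.filter fun x => ω ∈ openConn o x) :=
      Finset.filter_congr fun x _ => ⟨fun h => hqo.symm.trans h, fun h => hqo.trans h⟩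
    rw [heq]; exact hLω.2
  have hsL := measureReal_inter_add_sdiff (μ := μ) (s := L) (MeasurableSet.of_discrete (s := V)) (measure_ne_top _ _)
  have hsR := measureReal_inter_add_sdiff (μ := μ) (s := R) (MeasurableSet.of_discrete (s := V)) (measure_ne_top _ _)
  have h1 : μ.real (L ∩ V) ≤ μ.real (R ∩ V) := measureReal_mono hin (measure_ne_top _ _)
  have h2 : μ.real (L \ V) ≤ μ.real (R \ V) := by rw [hLV, hRV]; exact hCS
  linarith
  
end Summit.CriticalPhenomena.PercolationContinuityZ3.Theorems

end
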